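import Mathlib.Tactic.Ring
import Mathlib.Tactic.LinearCombination
import Mathlib.Tactic.FieldSimp
import Mathlib.Algebra.Field.Basic
import HarnessLib

/-!
# Ring 2 / AbelianAll — the genus-12 quotient `Y = C̃/⟨s⟩` of the (4,3,[2]) headline family (WEIL-2 gen 63)

research route, not a corollary; conditional on HC_CM plus one named minimal statement.
`HC_CM` occurs nowhere in this file; nothing here is a case of the Hodge conjecture.

Fact-free algebraic skeleton of PROPOSITION Y63 of the account `FIBRE-G63.md` (pub-hodge-ring2,
seat ab-weil-2, gen 63).  For a member of LEMMA Μ1's family — `X : y² = p₁ p₂`,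
`p₁ = (x-w₁)(x-w₂)`, `p₂ = p₁u₁² - D_q²`, `u = p₁u₁`, `f = (x-w₁)²(x-β)⁴(u+y)⁶/p₁³`,
`C̃ : φ¹² = f`, `r₀ = p₁²D_q/((x-w₁)(x-β)²(u+y)⁴)`, `s : (x,y,φ) ↦ (x,-y,φ⁷r₀)` — write
`A = x-w₁`, `B = x-β`, `C = x-w₂`, `Φ = φ⁶` (so `Φ² = f`).  The `s`-invariant function
`w := φ + s^*φ = φ(1 + Φ r₀)` generates the quotient curve `Y = C̃/⟨s⟩` over the conic
`L = C̃/⟨x², s⟩`, and the identities proved here assemble to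

* `theta_eq` : `f r₀² = (u-y)/(u+y)`;
* `sOne_sq` : `s₁ := B²(u+y)³/(C Φ)` satisfies `s₁² = p₁` — so `k(L) = k(x, √p₁)`, i.e. the conic
  `L` is branched over `w₁, w₂` (ERRATUM E-g63-1 to PAIRING-G62 §4.1 (i));
* `w_pow_six` : `w⁶ = Φ(1 + Φ r₀)⁶ = 8·A·B²·(D_q + u₁ s₁)³`,

i.e. `Y : w⁶ = 8(x-w₁)(x-β)²(D_q(x) + u₁(x)√p₁(x))³` over `L : s₁² = p₁(x)` — an explicit cyclic
sextic cover of `ℙ¹` of genus 12 whose primitive `ζ₆^{±1}`-piece of `H⁰(K)` has dimension `4+4`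
(the Weil-type 8-fold `Â` of THEOREM Y).  Only the definitions above and the two relations
`y² = u² - p₁D_q²`, `Φ² = f` are used; every step is `ring` / `field_simp` / `linear_combination`.
-/

namespace Summit.HodgeConjecture.Ring2AbelianAll.GenusTwelveQuotient

section RingIdentities

variable {R : Type*} [CommRing R]

/-- Odd/even splitting of `Φ(1+Φr)⁶` under `Φ² = f`:
`Φ(1+Φr)⁶ = (6fr + 20f²r³ + 6f³r⁵) + Φ(1 + 15fr² + 15f²r⁴ + f³r⁶)`. -/
theorem binomial_six_split (Φ r f : R) (hΦ : Φ ^ 2 = f) :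
    Φ * (1 + Φ * r) ^ 6
      = (6 * f * r + 20 * f ^ 2 * r ^ 3 + 6 * f ^ 3 * r ^ 5)
        + Φ * (1 + 15 * f * r ^ 2 + 15 * f ^ 2 * r ^ 4 + f ^ 3 * r ^ 6) := by
  linear_combination
    (6 * r + 15 * r ^ 2 * Φ + 20 * r ^ 3 * (Φ ^ 2 + f) + 15 * r ^ 4 * Φ * (Φ ^ 2 + f)
      + 6 * r ^ 5 * (Φ ^ 4 + Φ ^ 2 * f + f ^ 2) + r ^ 6 * Φ * (Φ ^ 4 + Φ ^ 2 * f + f ^ 2)) * hΦ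

/-- The odd part in terms of `θ = fr²` and `fr`: `6fr + 20f²r³ + 6f³r⁵ = 2(fr)(3 + 10θ + 3θ²)`. -/
theorem odd_part_theta (f r : R) :
    6 * f * r + 20 * f ^ 2 * r ^ 3 + 6 * f ^ 3 * r ^ 5
      = 2 * (f * r) * (3 + 10 * (f * r ^ 2) + 3 * (f * r ^ 2) ^ 2) := by
  ring

/-- The even part in terms of `θ = fr²`: `1 + 15θ + 15θ² + θ³ = (1+θ)(1 + 14θ + θ²)`. -/
theorem even_part_theta (θ : R) :
    1 + 15 * θ + 15 * θ ^ 2 + θ ^ 3 = (1 + θ) * (1 + 14 * θ + θ ^ 2) := by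
  ring

/-- `3(u+y)² + 10(u-y)(u+y) + 3(u-y)² = 16u² - 4y²`. -/
theorem odd_quadratic (u y : R) :
    3 * (u + y) ^ 2 + 10 * ((u - y) * (u + y)) + 3 * (u - y) ^ 2 = 16 * u ^ 2 - 4 * y ^ 2 := by
  ring

/-- `(u+y)² + 14(u-y)(u+y) + (u-y)² = 16u² - 12y²`. -/
theorem even_quadratic (u y : R) :
    (u + y) ^ 2 + 14 * ((u - y) * (u + y)) + (u - y) ^ 2 = 16 * u ^ 2 - 12 * y ^ 2 := by
  ring

/-- With `u = p₁u₁` and `y² = u² - p₁D²`:  `4u² - y² = p₁(3p₁u₁² + D²)`. -/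
theorem four_u_sq_sub_y_sq (p₁ u₁ D y : R) (hy : y ^ 2 = (p₁ * u₁) ^ 2 - p₁ * D ^ 2) :
    4 * (p₁ * u₁) ^ 2 - y ^ 2 = p₁ * (3 * p₁ * u₁ ^ 2 + D ^ 2) := by
  linear_combination (-1 : R) * hy

/-- With `u = p₁u₁` and `y² = u² - p₁D²`:  `4u² - 3y² = p₁(p₁u₁² + 3D²)`. -/
theorem four_u_sq_sub_three_y_sq (p₁ u₁ D y : R) (hy : y ^ 2 = (p₁ * u₁) ^ 2 - p₁ * D ^ 2) :
    4 * (p₁ * u₁) ^ 2 - 3 * y ^ 2 = p₁ * (p₁ * u₁ ^ 2 + 3 * D ^ 2) := by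
  linear_combination (-3 : R) * hy

/-- The cube: if `s² = p₁` then `D(3p₁u₁² + D²) + u₁(p₁u₁² + 3D²)s = (D + u₁ s)³`. -/
theorem cube_identity (D u₁ p₁ s : R) (hs : s ^ 2 = p₁) :
    D * (3 * p₁ * u₁ ^ 2 + D ^ 2) + u₁ * (p₁ * u₁ ^ 2 + 3 * D ^ 2) * s = (D + u₁ * s) ^ 3 := by
  linear_combination (-(3 * D * u₁ ^ 2) - u₁ ^ 3 * s) * hs

end RingIdentities

section FieldIdentities

variable {K : Type*} [Field K]

/-- `θ`-LEMMA: with `p₁D² = u² - y²` and `u + y ≠ 0`, `p₁D²/(u+y)² = (u-y)/(u+y)`. -/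
theorem theta_eq (p₁ D u y : K) (h : p₁ * D ^ 2 = u ^ 2 - y ^ 2) (huy : u + y ≠ 0) :
    p₁ * D ^ 2 / (u + y) ^ 2 = (u - y) / (u + y) := by
  rw [h, div_eq_div_iff (pow_ne_zero 2 huy) huy]
  ring

/-- `f r₀² = p₁D²/(u+y)²` for `f = A²B⁴(u+y)⁶/p₁³`, `r₀ = p₁²D/(AB²(u+y)⁴)`. -/
theorem f_mul_r0_sq (A B p₁ D v : K) (hA : A ≠ 0) (hB : B ≠ 0) (hp : p₁ ≠ 0) (hv : v ≠ 0) :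
    (A ^ 2 * B ^ 4 * v ^ 6 / p₁ ^ 3) * (p₁ ^ 2 * D / (A * B ^ 2 * v ^ 4)) ^ 2
      = p₁ * D ^ 2 / v ^ 2 := by
  field_simp

/-- `f r₀ = AB²D(u+y)²/p₁` for the same `f, r₀` (`v = u + y`). -/
theorem f_mul_r0 (A B p₁ D v : K) (hA : A ≠ 0) (hB : B ≠ 0) (hp : p₁ ≠ 0) (hv : v ≠ 0) :
    (A ^ 2 * B ^ 4 * v ^ 6 / p₁ ^ 3) * (p₁ ^ 2 * D / (A * B ^ 2 * v ^ 4))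
      = A * B ^ 2 * D * v ^ 2 / p₁ := by
  field_simp

/-- `s₁² = p₁`: for `p₁ = AC` and `Φ² = f = A²B⁴(u+y)⁶/p₁³`, the `⟨x²,s⟩`-invariant
`s₁ := B²(u+y)³/(CΦ)` is a square root of `p₁ = (x-w₁)(x-w₂)` (so `L = C̃/⟨x²,s⟩` is the conic
`s₁² = p₁(x)`, branched over `w₁` and `w₂`). Here `v = u + y`. -/
theorem sOne_sq (A B C v Φ : K) (hA : A ≠ 0) (hB : B ≠ 0) (hC : C ≠ 0) (hv : v ≠ 0) (hΦ : Φ ≠ 0)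
    (hΦsq : Φ ^ 2 = A ^ 2 * B ^ 4 * v ^ 6 / (A * C) ^ 3) :
    (B ^ 2 * v ^ 3 / (C * Φ)) ^ 2 = A * C := by
  have hAC : (A * C) ^ 3 ≠ 0 := pow_ne_zero 3 (mul_ne_zero hA hC)
  have key : Φ ^ 2 * (A * C) ^ 3 = A ^ 2 * B ^ 4 * v ^ 6 := by
    rw [hΦsq]; field_simp
  rw [div_pow, div_eq_iff (pow_ne_zero 2 (mul_ne_zero hC hΦ))]
  have : A * C * (C * Φ) ^ 2 * A ^ 2 = (B ^ 2 * v ^ 3) ^ 2 * A ^ 2 := by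
    have e : A * C * (C * Φ) ^ 2 * A ^ 2 = Φ ^ 2 * (A * C) ^ 3 := by ring
    rw [e, key]; ring
  have hA2 : A ^ 2 ≠ 0 := pow_ne_zero 2 hA
  exact (mul_right_cancel₀ hA2 this).symm


/-- `3 + 10θ + 3θ² = (16u² - 4y²)/(u+y)²` for `θ = (u-y)/(u+y)`. -/
theorem odd_theta_eval (u y : K) (hv : u + y ≠ 0) :
    3 + 10 * ((u - y) / (u + y)) + 3 * ((u - y) / (u + y)) ^ 2
      = (16 * u ^ 2 - 4 * y ^ 2) / (u + y) ^ 2 := by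
  rw [eq_div_iff (pow_ne_zero 2 hv)]
  field_simp
  ring

/-- `(1+θ)(1 + 14θ + θ²) = 2u(16u² - 12y²)/(u+y)³` for `θ = (u-y)/(u+y)`. -/
theorem even_theta_eval (u y : K) (hv : u + y ≠ 0) :
    (1 + (u - y) / (u + y)) * (1 + 14 * ((u - y) / (u + y)) + ((u - y) / (u + y)) ^ 2)
      = 2 * u * (16 * u ^ 2 - 12 * y ^ 2) / (u + y) ^ 3 := by
  rw [eq_div_iff (pow_ne_zero 3 hv)]
  field_simp
  ring

/-- PROPOSITION Y63 (the sextic model of `Y = C̃/⟨s⟩`).  With `p₁ = AC`, `u = p₁u₁`,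
`v = u + y`, `y² = u² - p₁D²` (the curve `X`), `f = A²B⁴v⁶/p₁³`, `r₀ = p₁²D/(AB²v⁴)`, `Φ² = f`
(`Φ = φ⁶` on `C̃ : φ¹² = f`) and `s₁ = B²v³/(CΦ)` (a square root of `p₁`, `sOne_sq`):
`w⁶ = Φ(1 + Φr₀)⁶ = 8AB²(D + u₁s₁)³`, i.e. `Y : w⁶ = 8(x-w₁)(x-β)²(D_q + u₁√p₁)³`.
The abbreviations are passed as variables with defining equations (instantiate with `rfl`). -/
theorem w_pow_six (A B C D u₁ y Φ p₁ u v f r₀ s₁ : K)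
    (hA : A ≠ 0) (hB : B ≠ 0) (hC : C ≠ 0) (hΦ : Φ ≠ 0)
    (hp₁ : p₁ = A * C) (hu : u = p₁ * u₁) (hvd : v = u + y) (hv : v ≠ 0)
    (hy : y ^ 2 = u ^ 2 - p₁ * D ^ 2)
    (hf : f = A ^ 2 * B ^ 4 * v ^ 6 / p₁ ^ 3) (hΦsq : Φ ^ 2 = f)
    (hr : r₀ = p₁ ^ 2 * D / (A * B ^ 2 * v ^ 4)) (hs : s₁ = B ^ 2 * v ^ 3 / (C * Φ)) :
    Φ * (1 + Φ * r₀) ^ 6 = 8 * A * B ^ 2 * (D + u₁ * s₁) ^ 3 := by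
  have hp : p₁ ≠ 0 := by rw [hp₁]; exact mul_ne_zero hA hC
  have huy : u + y ≠ 0 := by rw [← hvd]; exact hv
  have hyD : p₁ * D ^ 2 = u ^ 2 - y ^ 2 := by linear_combination hy
  have hΦAC : Φ ^ 2 = A ^ 2 * B ^ 4 * v ^ 6 / (A * C) ^ 3 := by rw [hΦsq, hf, hp₁]
  have hss : s₁ ^ 2 = p₁ := by
    rw [hs, hp₁]; exact sOne_sq A B C v Φ hA hB hC hv hΦ hΦAC
  have hθ : f * r₀ ^ 2 = (u - y) / (u + y) := by
    rw [hf, hr, f_mul_r0_sq A B p₁ D v hA hB hp hv, hvd]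
    exact theta_eq p₁ D u y hyD huy
  have hfr : f * r₀ = A * B ^ 2 * D * v ^ 2 / p₁ := by
    rw [hf, hr]; exact f_mul_r0 A B p₁ D v hA hB hp hv
  have hsplit := binomial_six_split Φ r₀ f hΦsq
  -- Φ² p₁³ = A² B⁴ (u+y)⁶ and the cancelled form Φ² C p₁² = A B⁴ (u+y)⁶
  have key : Φ ^ 2 * p₁ ^ 3 = A ^ 2 * B ^ 4 * (u + y) ^ 6 := by
    rw [hΦsq, hf, hvd]; field_simp
  have key2 : Φ ^ 2 * C * p₁ ^ 2 = A * B ^ 4 * (u + y) ^ 6 := by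
    apply mul_left_cancel₀ hA
    linear_combination key - (Φ ^ 2 * p₁ ^ 2) * hp₁
  -- odd part
  have h4 : 16 * u ^ 2 - 4 * y ^ 2 = 4 * (p₁ * (3 * p₁ * u₁ ^ 2 + D ^ 2)) := by
    rw [hu]; rw [hu] at hy; linear_combination (-4 : K) * hy
  have hodd : 6 * f * r₀ + 20 * f ^ 2 * r₀ ^ 3 + 6 * f ^ 3 * r₀ ^ 5
      = 8 * A * B ^ 2 * D * (3 * p₁ * u₁ ^ 2 + D ^ 2) := by
    rw [odd_part_theta, hθ, hfr, odd_theta_eval u y huy, h4, hvd]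
    field_simp
    ring
  -- even part
  have h4' : 16 * u ^ 2 - 12 * y ^ 2 = 4 * (p₁ * (p₁ * u₁ ^ 2 + 3 * D ^ 2)) := by
    have hy' := hy
    rw [hu] at hy' ⊢; linear_combination (-12 : K) * hy'
  have heven : Φ * (1 + 15 * (f * r₀ ^ 2) + 15 * (f * r₀ ^ 2) ^ 2 + (f * r₀ ^ 2) ^ 3)
      = 8 * A * B ^ 2 * (u₁ * (p₁ * u₁ ^ 2 + 3 * D ^ 2) * s₁) := by
    rw [even_part_theta, hθ, even_theta_eval u y huy, h4', hs, hvd]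
    field_simp
    linear_combination (8 * C * p₁ * Φ ^ 2 * (p₁ * u₁ ^ 2 + 3 * D ^ 2)) * hu
      + (8 * u₁ * (p₁ * u₁ ^ 2 + 3 * D ^ 2)) * key2
  -- assemble
  have hev : Φ * (1 + 15 * f * r₀ ^ 2 + 15 * f ^ 2 * r₀ ^ 4 + f ^ 3 * r₀ ^ 6)
      = Φ * (1 + 15 * (f * r₀ ^ 2) + 15 * (f * r₀ ^ 2) ^ 2 + (f * r₀ ^ 2) ^ 3) := by ring
  rw [hsplit, hev, hodd, heven, ← cube_identity D u₁ p₁ s₁ hss]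
  ring

end FieldIdentities

end Summit.HodgeConjecture.Ring2AbelianAll.GenusTwelveQuotient
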